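import Literature.Computability.AlgebraicComplexity.LaserFormatMethod
import HarnessLib

/-!
# Splitting a laser block along a concatenated label word (format-value bookkeeping)

Bookkeeping for TWO-STAGE laser extractions (Le Gall 2012, §6.1: after the outer extraction on
`CW_q^{⊗2}` with the coarse 15-block labelling, the positions of a block `t^{⊗N}(w)` carrying the
letters `[112]`, `[121]`, `[211]` are analysed JOINTLY — Prop. 6.1/6.2 — while the remaining
positions carry matrix products valued one by one).  In the tree's currency
(`HasFormatValue`, `laserBlock = kroneckerPi` of the components) this needs:

* `tensorRestrictsTo_kroneckerPi_append`, `tensorRestrictsTo_kroneckerTensor_kroneckerPi_append` —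
  `⊗_{ρ<m+n} (T ++ T')_ρ ≅ (⊗_{ρ<m} T_ρ) ⊗ (⊗_{ρ<n} T'_ρ)` (both restrictions, relabelling along
  `Fin.append`);
* `HasFormatValue.kroneckerPi_append` — hence values multiply over a concatenated family;
* `laserBlock_append`, `HasFormatValue.laserBlock_append` — the block of a concatenated label word
  `w ++ w'` is the Kronecker product of the two blocks, so its value is the product of a value of
  `t^{⊗m}(w)` (e.g. positionwise, `HasFormatValue.kroneckerPi`) and a value of `t^{⊗n}(w')`
  (e.g. a joint extraction over the family positions);
* `letterCount_append` — types add under concatenation;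
* `HasFormatValue.laserBlock_of_letterCount_eq`, `hasFormatValue_laserBlock_of_append` — blocks of
  the same type are relabellings of each other (`tensorRestrictsTo_laserBlock_of_letterCount_eq`),
  so ONE valued word per type suffices, in particular a concatenated one: this is the form consumed
  by the word-value laser theorem `laserMethod_hasFormatValue_of_blockValue` (hypothesis `hW`).

All statements proved; no named facts.
-/

namespace Literature.Computability.AlgebraicComplexity

open Finset

universe u

variable {K : Type u} [Field K]
variable {ι κ μ : Type} [Fintype ι] [Fintype κ] [Fintype μ] [DecidableEq ι] [DecidableEq κ]
  [DecidableEq μ]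

/-! ## Kronecker products of concatenated families -/

section Append

/-- `⊗_{ρ<m+n} (T ++ T')_ρ ≥ (⊗_{ρ<m} T_ρ) ⊗ (⊗_{ρ<n} T'_ρ)`: relabelling along `Fin.append`
(`∏_{ρ<m+n} = ∏_{ρ<m} · ∏_{ρ<n}`, `Fin.prod_univ_add`). [cite: LeGall2014, Appendix A.3] -/
theorem tensorRestrictsTo_kroneckerPi_append {m n : ℕ} (T : Fin m → ι → κ → μ → K)
    (T' : Fin n → ι → κ → μ → K) :
    TensorRestrictsTo (kroneckerPi (Fin.append T T'))
      (kroneckerTensor (kroneckerPi T) (kroneckerPi T')) := by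
  have key : kroneckerTensor (kroneckerPi T) (kroneckerPi T') = fun a b c =>
      kroneckerPi (Fin.append T T') (Fin.append a.1 a.2) (Fin.append b.1 b.2)
        (Fin.append c.1 c.2) := by
    funext a b c
    simp only [kroneckerTensor_apply, kroneckerPi_apply, Fin.prod_univ_add, Fin.append_left,
      Fin.append_right]
  rw [key]
  exact tensorRestrictsTo_precomp _ _ _ _

/-- Conversely `(⊗_{ρ<m} T_ρ) ⊗ (⊗_{ρ<n} T'_ρ) ≥ ⊗_{ρ<m+n} (T ++ T')_ρ` (relabelling along the
splitting `a ↦ (a ∘ castAdd, a ∘ natAdd)`), so the two are isomorphic. [cite: LeGall2014, Appendix A.3] -/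
theorem tensorRestrictsTo_kroneckerTensor_kroneckerPi_append {m n : ℕ} (T : Fin m → ι → κ → μ → K)
    (T' : Fin n → ι → κ → μ → K) :
    TensorRestrictsTo (kroneckerTensor (kroneckerPi T) (kroneckerPi T'))
      (kroneckerPi (Fin.append T T')) := by
  have key : kroneckerPi (Fin.append T T') = fun a b c =>
      kroneckerTensor (kroneckerPi T) (kroneckerPi T')
        (fun ρ => a (Fin.castAdd n ρ), fun ρ => a (Fin.natAdd m ρ))
        (fun ρ => b (Fin.castAdd n ρ), fun ρ => b (Fin.natAdd m ρ))
        (fun ρ => c (Fin.castAdd n ρ), fun ρ => c (Fin.natAdd m ρ)) := by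
    funext a b c
    simp only [kroneckerTensor_apply, kroneckerPi_apply, Fin.prod_univ_add, Fin.append_left,
      Fin.append_right]
  rw [key]
  exact tensorRestrictsTo_precomp _ _ _ _

/-- **Values multiply over a concatenated family**: values of `⊗_{ρ<m} T_ρ` and `⊗_{ρ<n} T'_ρ`
(parameters `≥ 0`) give the product value of `⊗_{ρ<m+n} (T ++ T')_ρ`.
[cite: LeGall2014, §2.2] -/
theorem HasFormatValue.kroneckerPi_append {m n : ℕ} {T : Fin m → ι → κ → μ → K}
    {T' : Fin n → ι → κ → μ → K} {v A B C v' A' B' C' : ℝ}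
    (h : HasFormatValue (Literature.Computability.AlgebraicComplexity.kroneckerPi T) v A B C)
    (h' : HasFormatValue (Literature.Computability.AlgebraicComplexity.kroneckerPi T') v' A' B' C')
    (hv : 0 ≤ v) (hv' : 0 ≤ v') (hA : 0 ≤ A) (hA' : 0 ≤ A') (hB : 0 ≤ B) (hB' : 0 ≤ B')
    (hC : 0 ≤ C) (hC' : 0 ≤ C') :
    HasFormatValue (Literature.Computability.AlgebraicComplexity.kroneckerPi (Fin.append T T'))
      (v * v') (A * A') (B * B') (C * C') :=
  -- (`kroneckerPi` spelled out: inside `HasFormatValue.kroneckerPi_append` the short name is a lemma)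
  (h.kronecker h' hv hv' hA hA' hB hB' hC hC').of_restrictsTo
    (tensorRestrictsTo_kroneckerPi_append T T')

end Append

/-! ## Blocks of concatenated label words -/

section Blocks

variable {I J L : Type} [DecidableEq I] [DecidableEq J] [DecidableEq L]

omit [Fintype ι] [Fintype κ] [Fintype μ] [DecidableEq ι] [DecidableEq κ] [DecidableEq μ] in
/-- The block of `t^{⊗(m+n)}` with label word `w ++ w'` is the Kronecker product of the
concatenated family of components. [cite: LeGall2014, Appendix A.3] -/
theorem laserBlock_append (bI : ι → I) (bJ : κ → J) (bL : μ → L) (t : ι → κ → μ → K) {m n : ℕ}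
    (w : Fin m → I × J × L) (w' : Fin n → I × J × L) :
    laserBlock bI bJ bL t (Fin.append w w') = kroneckerPi (Fin.append
      (fun ρ => partSubtensor bI bJ bL t {(w ρ).1} {(w ρ).2.1} {(w ρ).2.2})
      (fun ρ => partSubtensor bI bJ bL t {(w' ρ).1} {(w' ρ).2.1} {(w' ρ).2.2})) := by
  unfold laserBlock
  congr 1
  funext ρ
  refine Fin.addCases (fun i => ?_) (fun j => ?_) ρ
  · simp only [Fin.append_left]
  · simp only [Fin.append_right]

/-- **The value of a block splits along a concatenation of its label word**: values of
`t^{⊗m}(w)` and `t^{⊗n}(w')` (parameters `≥ 0`) give the product value of `t^{⊗(m+n)}(w ++ w')`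
(the two-stage bookkeeping of Le Gall 2012, §6.1: matrix-product positions valued one by one, the
`[112]/[121]/[211]`-positions jointly). [cite: LeGall2012, §6.1] [cite: LeGall2014, Appendix A.3] -/
theorem HasFormatValue.laserBlock_append (bI : ι → I) (bJ : κ → J) (bL : μ → L)
    (t : ι → κ → μ → K) {m n : ℕ} {w : Fin m → I × J × L} {w' : Fin n → I × J × L}
    {v A B C v' A' B' C' : ℝ}
    (h : HasFormatValue (laserBlock bI bJ bL t w) v A B C)
    (h' : HasFormatValue (laserBlock bI bJ bL t w') v' A' B' C')
    (hv : 0 ≤ v) (hv' : 0 ≤ v') (hA : 0 ≤ A) (hA' : 0 ≤ A') (hB : 0 ≤ B) (hB' : 0 ≤ B')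
    (hC : 0 ≤ C) (hC' : 0 ≤ C') :
    HasFormatValue (laserBlock bI bJ bL t (Fin.append w w')) (v * v') (A * A') (B * B')
      (C * C') := by
  rw [Literature.Computability.AlgebraicComplexity.laserBlock_append]
  exact h.kroneckerPi_append h' hv hv' hA hA' hB hB' hC hC'

omit [DecidableEq J] [DecidableEq L] in
/-- Types add under concatenation: `letterCount (w ++ w') = letterCount w + letterCount w'`.
[folklore] [cite: LeGall2014, Appendix A.3] -/
theorem letterCount_append {α : Type} [DecidableEq α] {m n : ℕ} (w : Fin m → α) (w' : Fin n → α) :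
    letterCount (Fin.append w w') = letterCount w + letterCount w' := by
  funext s
  simp only [letterCount, Pi.add_apply, Finset.card_filter, Fin.sum_univ_add, Fin.append_left,
    Fin.append_right]

variable [Fintype I] [Fintype J] [Fintype L]

/-- Blocks of the same type have the same values (they are relabellings of each other,
`tensorRestrictsTo_laserBlock_of_letterCount_eq`). [cite: LeGall2014, Appendix A.3 (p. 24)] -/
theorem HasFormatValue.laserBlock_of_letterCount_eq (bI : ι → I) (bJ : κ → J) (bL : μ → L)
    (t : ι → κ → μ → K) {N : ℕ} {w₀ w : Fin N → I × J × L} {v A B C : ℝ}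
    (h : HasFormatValue (laserBlock bI bJ bL t w₀) v A B C) (hw : letterCount w = letterCount w₀) :
    HasFormatValue (laserBlock bI bJ bL t w) v A B C :=
  h.of_restrictsTo (tensorRestrictsTo_laserBlock_of_letterCount_eq bI bJ bL t hw)

/-- **One concatenated valued word per type suffices**: if some word `w₀` of type `c` has a block
of value `(v, A, B, C)` and some word `w₀'` of type `c'` one of value `(v', A', B', C')` (parameters
`≥ 0`), then EVERY block of `t^{⊗(m+n)}` of type `c + c'` has value `(vv', AA', BB', CC')` — the shape
of hypothesis `hW` of `laserMethod_hasFormatValue_of_blockValue` for a two-stage analysis.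
[cite: LeGall2012, §6.1] [cite: LeGall2014, Appendix A.3] -/
theorem hasFormatValue_laserBlock_of_append (bI : ι → I) (bJ : κ → J) (bL : μ → L)
    (t : ι → κ → μ → K) {m n : ℕ} {c c' : I × J × L → ℕ}
    {w₀ : Fin m → I × J × L} (hw₀ : letterCount w₀ = c)
    {w₀' : Fin n → I × J × L} (hw₀' : letterCount w₀' = c')
    {v A B C v' A' B' C' : ℝ}
    (h : HasFormatValue (laserBlock bI bJ bL t w₀) v A B C)
    (h' : HasFormatValue (laserBlock bI bJ bL t w₀') v' A' B' C')
    (hv : 0 ≤ v) (hv' : 0 ≤ v') (hA : 0 ≤ A) (hA' : 0 ≤ A') (hB : 0 ≤ B) (hB' : 0 ≤ B')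
    (hC : 0 ≤ C) (hC' : 0 ≤ C') (u : Fin (m + n) → I × J × L) (hu : letterCount u = c + c') :
    HasFormatValue (laserBlock bI bJ bL t u) (v * v') (A * A') (B * B') (C * C') := by
  refine (h.laserBlock_append bI bJ bL t h' hv hv' hA hA' hB hB' hC hC').laserBlock_of_letterCount_eq
    bI bJ bL t ?_
  rw [hu, letterCount_append, hw₀, hw₀']

end Blocks

end Literature.Computability.AlgebraicComplexity
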